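import Literature.Computability.AlgebraicComplexity.IK2020Hypergraphs
import HarnessLib

/-!
# Ikenmeyer–Kandasamy 2020, §14/§16: counting in `(D,K)`-hypergraphs (Claim 26 / 16.5)

References: C. Ikenmeyer, U. Kandasamy, "Implementing geometric complexity theory: on the
separation of orbit closures via symmetries", STOC 2020 / arXiv:1911.03990 (bib key
`IkenmeyerKandasamy2019`), Def. 14.1 (TeX L1251–1266; chunk p0021.txt:L16–33) and §16, Claim 26
= printed Claim 16.5 'EVENcla:divisibility' (chunk p0023.txt:L28–58).

Brick of the multi-seat program for the named fact `IK2020_thm_13_1` (route note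
`HOME/bip/NOTE-t08g4-IK2020Thm131-route.md`, bricks E2/E3), on top of t08 g0's
`IK2020.Hypergraph.IsDK` (`AC/IK2020Hypergraphs.lean`). No named fact; net debt 0. Contents:

* set partitions (`IK2020.Hypergraph.IsPartitionBy`): members are pairwise disjoint and cover,
  `∑ sizes = |V|` (`IsPartitionBy.sum_card`); the member `part v` containing a vertex (this is the
  name edge `ℓ(v)` / block edge `k(v)` of §15, TeX "for each vertex `v` in `H^{(i)}` we define
  `ℓ(v)` to be the index of its corresponding name edge") with its fibres (`filter_part_eq`:
  "the symbol `i_ℓ` appears exactly as many times as there are vertices `v` with `ℓ(v) = ℓ`",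
  Claim 25, is then the size of the name edge);
* for a `(D,K)`-hypergraph: `|V| = D · |E_Block|` (`IsDK.card_eq`), `∑_{e ∈ E_Name} |e| = D |E_Block|`
  (`IsDK.sum_card_names`), and **Claim 26**: `∑_{e ∈ E_Name} (D - |e|) = D K`
  (`IsDK.sum_sub_card_names`) — the divisibility count showing that the greedy construction of
  `rightpart(T)` replaces exactly all `D ϱ_i` entries `i` of `S`; also `2 ≤ D`, and both edge
  sets are nonempty.
-/

namespace Literature.Computability.AlgebraicComplexity

namespace IK2020

namespace Hypergraph

open Finset

variable {V : Type*}

/-! ## Set partitions -/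

namespace IsPartitionBy

variable {E : Finset (Finset V)}

/-- The members of a set partition are pairwise disjoint (TeX L1250: "pairwise disjoint subsets").
[cite: IkenmeyerKandasamy2019, §14] -/
theorem pairwiseDisjoint [DecidableEq V] (hE : IsPartitionBy E) :
    (E : Set (Finset V)).PairwiseDisjoint id := by
  intro e he e' he' hne
  rw [Function.onFun, id, id, Finset.disjoint_left]
  intro v hv hv'
  obtain ⟨e₀, -, huniq⟩ := hE v
  exact hne ((huniq e ⟨he, hv⟩).trans (huniq e' ⟨he', hv'⟩).symm)

/-- The members of a set partition cover the vertex set (TeX L1250: "whose union is `X`").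
[cite: IkenmeyerKandasamy2019, §14] -/
theorem biUnion_eq_univ [DecidableEq V] [Fintype V] (hE : IsPartitionBy E) :
    E.biUnion id = univ := by
  ext v
  simp only [mem_biUnion, id, mem_univ, iff_true]
  obtain ⟨e, ⟨he, hv⟩, -⟩ := hE v
  exact ⟨e, he, hv⟩

/-- **The sizes of the members of a set partition add up to `|V|`.**
[cite: IkenmeyerKandasamy2019, §14] -/
theorem sum_card [DecidableEq V] [Fintype V] (hE : IsPartitionBy E) :
    ∑ e ∈ E, e.card = Fintype.card V := by
  rw [← Finset.card_univ, ← hE.biUnion_eq_univ, Finset.card_biUnion hE.pairwiseDisjoint]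
  rfl

/-- **The member of the partition containing `v`** — for `E = E_Name` this is (the name edge
indexed by) `ℓ(v)`, for `E = E_Block` it is `k(v)` (§15, TeX L1770–1784; chunk p0021.txt:L97–110:
"for each vertex `v` in `H^{(i)}` we define `ℓ(v)` to be the index of its corresponding name edge
… `k(v)` to be the index of its corresponding block edge"). [cite: IkenmeyerKandasamy2019, §15] -/
noncomputable def part (hE : IsPartitionBy E) (v : V) : Finset V :=
  (hE v).exists.choose

/-- [cite: IkenmeyerKandasamy2019, §15] -/
theorem part_mem (hE : IsPartitionBy E) (v : V) : hE.part v ∈ E :=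
  (hE v).exists.choose_spec.1

/-- [cite: IkenmeyerKandasamy2019, §15] -/
theorem mem_part (hE : IsPartitionBy E) (v : V) : v ∈ hE.part v :=
  (hE v).exists.choose_spec.2

/-- Uniqueness: any member containing `v` is `part v`. [cite: IkenmeyerKandasamy2019, §15] -/
theorem eq_part (hE : IsPartitionBy E) {v : V} {e : Finset V} (he : e ∈ E) (hv : v ∈ e) :
    e = hE.part v :=
  (hE v).unique ⟨he, hv⟩ ⟨hE.part_mem v, hE.mem_part v⟩

/-- Two vertices have the same part iff they lie in a common member.
[cite: IkenmeyerKandasamy2019, §15] -/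
theorem part_eq_part_iff (hE : IsPartitionBy E) {v w : V} :
    hE.part v = hE.part w ↔ ∃ e ∈ E, v ∈ e ∧ w ∈ e := by
  constructor
  · intro h
    exact ⟨hE.part v, hE.part_mem v, hE.mem_part v, h ▸ hE.mem_part w⟩
  · rintro ⟨e, he, hv, hw⟩
    rw [← hE.eq_part he hv, ← hE.eq_part he hw]

/-- **The fibre of `part` over a member `e` is `e` itself**: the vertices `v` with `ℓ(v) = ℓ` are
exactly the vertices of the `ℓ`-th name edge (this is the content of Claim 25 / §16: "`i_ℓ` appears
exactly as many times as there are vertices `v` in `H^{(i)}` with `ℓ(v) = ℓ`", and "`n(i_ℓ) < D`"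
then follows from Def. 14.1 (4)). [cite: IkenmeyerKandasamy2019, §16] -/
theorem filter_part_eq [DecidableEq V] [Fintype V] (hE : IsPartitionBy E) {e : Finset V}
    (he : e ∈ E) : univ.filter (fun v => hE.part v = e) = e := by
  ext v
  simp only [mem_filter, mem_univ, true_and]
  constructor
  · rintro rfl
    exact hE.mem_part v
  · intro hv
    exact (hE.eq_part he hv).symm

/-- The number of vertices whose part is `e ∈ E` is `|e|`. [cite: IkenmeyerKandasamy2019, §16] -/
theorem card_filter_part_eq [DecidableEq V] [Fintype V] (hE : IsPartitionBy E) {e : Finset V}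
    (he : e ∈ E) : (univ.filter fun v => hE.part v = e).card = e.card := by
  rw [hE.filter_part_eq he]

end IsPartitionBy

/-! ## Counting in a `(D,K)`-hypergraph -/

namespace IsDK

variable [DecidableEq V] {H : Hypergraph V} {D K : ℕ} {link : V}

/-- A `(D,K)`-hypergraph has a block edge (the one through the link vertex).
[cite: IkenmeyerKandasamy2019, Def. 14.1] -/
theorem blocks_nonempty (h : H.IsDK D K link) : H.blocks.Nonempty := by
  obtain ⟨-, -, eB, heB, -⟩ := h.link_mem
  exact ⟨eB, heB⟩

/-- A `(D,K)`-hypergraph has a name edge (the one through the link vertex).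
[cite: IkenmeyerKandasamy2019, Def. 14.1] -/
theorem names_nonempty (h : H.IsDK D K link) : H.names.Nonempty := by
  obtain ⟨eN, heN, -⟩ := h.link_mem
  exact ⟨eN, heN⟩

/-- Def. 14.1 (6) forces `D ≥ 2` (a block edge contains two vertices of a name edge).
[cite: IkenmeyerKandasamy2019, Def. 14.1] -/
theorem two_le (h : H.IsDK D K link) : 2 ≤ D := by
  obtain ⟨eN, -, eB, heB, -, -, h2⟩ := h.link_mem
  calc 2 ≤ (eN ∩ eB).card := h2
    _ ≤ eB.card := Finset.card_le_card Finset.inter_subset_right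
    _ = D := h.card_block eB heB

variable [Fintype V]

/-- `∑_{e ∈ E_Block} |e| = |V|` (the block edges partition `V`). [cite: IkenmeyerKandasamy2019, Def. 14.1] -/
theorem sum_card_blocks (h : H.IsDK D K link) : ∑ e ∈ H.blocks, e.card = Fintype.card V :=
  h.blocks_partition.sum_card

/-- **`|V| = D · |E_Block|`** (Def. 14.1 (3); §15: "the number of columns in `leftpart(T)` is
equal to the total number of vertices in the hypergraphs"). [cite: IkenmeyerKandasamy2019, §15] -/
theorem card_eq (h : H.IsDK D K link) : Fintype.card V = D * H.blocks.card := by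
  rw [← h.sum_card_blocks, Finset.sum_const_nat fun e he => h.card_block e he, mul_comm]

/-- **`∑_{e ∈ E_Name} |e| = D |E_Block|`** (proof of Claim 26: "block edges form a set partition of
`V` and each block edge has size `D` … the name edges form a set partition of `V`").
[cite: IkenmeyerKandasamy2019, §16] -/
theorem sum_card_names (h : H.IsDK D K link) : ∑ e ∈ H.names, e.card = D * H.blocks.card := by
  rw [h.names_partition.sum_card, h.card_eq]

/-- **IK Claim 26 (printed Claim 16.5, 'EVENcla:divisibility'), hypergraph form**:
`∑_{e ∈ E_Name} (D - |e|) = D K` for a `(D,K)`-hypergraph — from `|E_Name| - |E_Block| = K`,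
`∑_{e ∈ E_Name} |e| = D |E_Block|` and `|e| < D` for name edges (chunk p0023.txt:L28–58). With
`K = ϱ_i` this is "`∑_ℓ (D - n(i_ℓ)) = D ϱ_i`": replacing, for each name edge `ℓ` of `H^{(i)}`,
exactly `D - n(i_ℓ)` entries `i` of `S` by `i_ℓ` uses up all `D ϱ_i` entries `i`.
[cite: IkenmeyerKandasamy2019, §16] -/
theorem sum_sub_card_names (h : H.IsDK D K link) : ∑ e ∈ H.names, (D - e.card) = D * K := by
  have h1 : ∑ e ∈ H.names, (D - e.card) + ∑ e ∈ H.names, e.card = ∑ e ∈ H.names, D := by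
    rw [← Finset.sum_add_distrib]
    exact Finset.sum_congr rfl fun e he => Nat.sub_add_cancel (h.card_name e he).2.le
  rw [Finset.sum_const, smul_eq_mul, h.card_names, h.sum_card_names] at h1
  have h2 : (H.blocks.card + K) * D = D * H.blocks.card + D * K := by ring
  omega

omit [Fintype V] in
/-- Each name-edge deficiency `D - |e|` lies in `[1, D-1]` (Def. 14.1 (4): `1 ≤ |e| < D`), so a
symbol `i_ℓ` occurs in BOTH parts of `T` (§16: "`0 < n(i_ℓ) < D` iff `0 < D - n(i_ℓ) < D`").
[cite: IkenmeyerKandasamy2019, §16] -/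
theorem sub_card_name_pos (h : H.IsDK D K link) {e : Finset V} (he : e ∈ H.names) :
    0 < D - e.card ∧ D - e.card < D := by
  have := h.card_name e he
  omega

end IsDK

end Hypergraph

end IK2020

end Literature.Computability.AlgebraicComplexity
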